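import Mathlib
import Literature.AlgebraicGeometry.Tropical.InitialIdeal
import Literature.AlgebraicGeometry.Tropical.SchonIdeal
import Literature.AlgebraicGeometry.Tropical.TropicalLink
import Summits.ResolutionOfSingularities.ResolutionOfSingularities.Theorems.TropicalLinksInductiveStepWeightZero

/-!
# TropicalLinks / InductiveStep — schön-ness is invariant under unimodular changes of coordinates

Route `ResolutionOfSingularities/TropicalLinks`, crux `InductiveStep`
(stmt-ResolutionOfSingularities-17233), line `split`: brick B1 in support of stub
`stub_sncClosureSchon` (the first half of the intrinsic-torus / subtorus-coset reduction of the
Gröbner dictionary).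

A unimodular change of coordinates `e : ℤ^N ≃+ ℤ^N` of the torus `𝔾_m^N` acts on the Laurent
polynomial ring `k[ℤ^N] = AddMonoidAlgebra k (Fin N → ℤ)` by the monomial algebra automorphism
`k[e] = AddMonoidAlgebra.domCongr k k e`. For a weight `w' ∈ ℤ^N` on the target put
`w = w' ∘ e`, i.e. `wᵢ = ⟨w', e(eᵢ)⟩`, so that `⟨w', e v⟩ = ⟨w, v⟩`; then initial forms commute with
`k[e]` (`in_{w'}(k[e] f) = k[e](in_w f)`), hence `in_{w'}(k[e] I) = k[e](in_w I)` and
`k[ℤ^N] ⧸ in_{w'}(k[e] I) ≅ k[ℤ^N] ⧸ in_w I`. Regularity at all primes being invariant under ring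
isomorphisms (`tropicalLinks_forall_prime_regular_of_ringEquiv`), `IsSchonIdeal I` implies
`IsSchonIdeal (I.map k[e])`; the converse is the same statement for `e⁻¹`, as
`k[e⁻¹](k[e] I) = I`. Main result: `tropicalLinks_isSchonIdeal_map_domCongr_iff`.
-/

set_option linter.dupNamespace false -- single-conjunct summit: doubled namespace component is mandated

namespace Summit.ResolutionOfSingularities.ResolutionOfSingularities.Theorems

open AddMonoidAlgebra Literature.AlgebraicGeometry.Tropical

/-! ### Initial forms and initial ideals under a monomial change of coordinates -/

/-- **Initial forms commute with a monomial change of coordinates**: for `e : M ≃+ M'` and a weight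
map `φ` on `M'`, `in_φ(k[e] f) = k[e](in_{φ ∘ e} f)`. [folklore] -/
theorem tropicalLinks_initialForm_domCongr {k : Type*} [CommSemiring k] {M M' : Type*}
    [AddMonoid M] [AddMonoid M'] {Λ : Type*} [LinearOrder Λ] (e : M ≃+ M') (φ : M' → Λ)
    (f : AddMonoidAlgebra k M) :
    initialForm φ (domCongr k k e f) = domCongr k k e (initialForm (φ ∘ e) f) := by
  apply coeff_injective
  ext n
  rw [coeff_initialForm_apply, coeff_domCongr, coeff_domCongr, coeff_initialForm_apply,
    domCongr_support]
  simp only [Finset.forall_mem_map, Function.comp_apply, AddEquiv.apply_symm_apply]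
  rfl

/-- The image of an ideal under a monomial change of coordinates is, as a set, the image.
[folklore] -/
theorem tropicalLinks_coe_map_domCongr {k : Type*} [CommSemiring k] {M M' : Type*}
    [AddMonoid M] [AddMonoid M'] (e : M ≃+ M') (I : Ideal (AddMonoidAlgebra k M)) :
    ((I.map (domCongr k k e) : Ideal (AddMonoidAlgebra k M')) : Set (AddMonoidAlgebra k M')) =
      domCongr k k e '' (I : Set (AddMonoidAlgebra k M)) := by
  ext y
  rw [SetLike.mem_coe, Ideal.mem_map_of_equiv, Set.mem_image]
  rfl

/-- **Initial ideals commute with a monomial change of coordinates**: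
`in_φ(k[e] I) = k[e](in_{φ ∘ e} I)`. [folklore] -/
theorem tropicalLinks_initialIdeal_map_domCongr {k : Type*} [CommSemiring k] {M M' : Type*}
    [AddMonoid M] [AddMonoid M'] {Λ : Type*} [LinearOrder Λ] (e : M ≃+ M') (φ : M' → Λ)
    (I : Ideal (AddMonoidAlgebra k M)) :
    initialIdeal φ (I.map (domCongr k k e)) = (initialIdeal (φ ∘ e) I).map (domCongr k k e) := by
  unfold initialIdeal
  rw [Ideal.map_span, tropicalLinks_coe_map_domCongr, ← Set.image_comp, ← Set.image_comp]
  congr 2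
  funext f
  exact tropicalLinks_initialForm_domCongr e φ f

/-- `k[e⁻¹](k[e] I) = I`. [folklore] -/
theorem tropicalLinks_map_domCongr_map_domCongr_symm {k : Type*} [CommSemiring k] {M M' : Type*}
    [AddMonoid M] [AddMonoid M'] (e : M ≃+ M') (I : Ideal (AddMonoidAlgebra k M)) :
    (I.map (domCongr k k e)).map (domCongr k k e.symm) = I := by
  ext x
  rw [mem_map_domCongr_iff, mem_map_domCongr_iff]
  exact Iff.of_eq (congrArg (· ∈ I) ((domCongr k k e).symm_apply_apply x))

/-! ### Integer weights under a unimodular change of coordinates -/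

/-- `⟨w, eᵢ⟩ = wᵢ`. [folklore] -/
theorem tropicalLinks_dotWeight_single {N : ℕ} (w : Fin N → ℤ) (i : Fin N) (x : ℤ) :
    dotWeight w (Pi.single i x) = w i * x := by
  classical
  simp [dotWeight, Pi.single_apply]

/-- **Pull-back of a weight along a unimodular change of coordinates**: for `e : ℤ^N ≃+ ℤ^N` and
`w' ∈ ℤ^N`, the weight `wᵢ = ⟨w', e(eᵢ)⟩` satisfies `⟨w', e v⟩ = ⟨w, v⟩` for all `v`. [folklore] -/
theorem tropicalLinks_dotWeight_comp_addEquiv {N : ℕ} (w' : Fin N → ℤ)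
    (e : (Fin N → ℤ) ≃+ (Fin N → ℤ)) :
    dotWeight w' ∘ e = dotWeight (fun i => dotWeight w' (e (Pi.single i 1))) := by
  have h : (dotWeightHom w').comp e.toAddMonoidHom =
      dotWeightHom (fun i => dotWeight w' (e (Pi.single i 1))) := by
    refine AddMonoidHom.functions_ext' ℤ _ _ fun i => AddMonoidHom.ext_int ?_
    simp [tropicalLinks_dotWeight_single]
  have := congrArg (fun g : (Fin N → ℤ) →+ ℤ => (g : (Fin N → ℤ) → ℤ)) h
  simpa using this

/-- **Initial ideals of `k[e] I` are images of initial ideals of `I`**: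
`in_{w'}(k[e] I) = k[e](in_w I)` with `wᵢ = ⟨w', e(eᵢ)⟩`. [folklore] -/
theorem tropicalLinks_weightInitialIdeal_map_domCongr {k : Type*} [CommSemiring k] {N : ℕ}
    (e : (Fin N → ℤ) ≃+ (Fin N → ℤ)) (w' : Fin N → ℤ)
    (I : Ideal (AddMonoidAlgebra k (Fin N → ℤ))) :
    weightInitialIdeal w' (I.map (domCongr k k e)) =
      (weightInitialIdeal (fun i => dotWeight w' (e (Pi.single i 1))) I).map (domCongr k k e) := by
  rw [weightInitialIdeal, tropicalLinks_initialIdeal_map_domCongr, tropicalLinks_dotWeight_comp_addEquiv]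

/-! ### Schön-ness under a unimodular change of coordinates -/

/-- **Schön-ness is preserved by a unimodular change of coordinates** (one direction): if every
initial degeneration of `I` is regular, so is every initial degeneration of `k[e] I`, since
`k[ℤ^N] ⧸ in_{w'}(k[e] I) ≅ k[ℤ^N] ⧸ in_w(I)` for the pulled-back weight `w`. [folklore] -/
theorem tropicalLinks_isSchonIdeal_map_domCongr {k : Type} [Field k] {N : ℕ}
    (e : (Fin N → ℤ) ≃+ (Fin N → ℤ)) {I : Ideal (AddMonoidAlgebra k (Fin N → ℤ))}
    (h : IsSchonIdeal I) : IsSchonIdeal (I.map (domCongr k k e)) := by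
  intro w' P _
  have hJ := tropicalLinks_weightInitialIdeal_map_domCongr (k := k) e w' I
  have E : (AddMonoidAlgebra k (Fin N → ℤ) ⧸
      weightInitialIdeal (fun i => dotWeight w' (e (Pi.single i 1))) I) ≃ₐ[k]
      (AddMonoidAlgebra k (Fin N → ℤ) ⧸ weightInitialIdeal w' (I.map (domCongr k k e))) :=
    Ideal.quotientEquivAlg _ _ (domCongr k k e) hJ
  exact tropicalLinks_forall_prime_regular_of_ringEquiv E.toRingEquiv (h _) P

/-- **Schön-ness is invariant under unimodular changes of coordinates of the torus** (brick B1):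
for `e : ℤ^N ≃+ ℤ^N` acting on `k[ℤ^N]` by the monomial automorphism `k[e] = domCongr k k e`,
the ideal `k[e] I` is schön iff `I` is. The forward implication is the backward one for `e⁻¹`,
as `k[e⁻¹](k[e] I) = I`. [folklore] -/
theorem tropicalLinks_isSchonIdeal_map_domCongr_iff :
    ∀ (k : Type) [Field k] (N : ℕ) (e : (Fin N → ℤ) ≃+ (Fin N → ℤ)) (I : Ideal (AddMonoidAlgebra k (Fin N → ℤ))), Literature.AlgebraicGeometry.Tropical.IsSchonIdeal (I.map (AddMonoidAlgebra.domCongr k k e)) ↔ Literature.AlgebraicGeometry.Tropical.IsSchonIdeal I := by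
  intro k _ N e I
  constructor
  · intro h
    have h' := tropicalLinks_isSchonIdeal_map_domCongr e.symm h
    rwa [tropicalLinks_map_domCongr_map_domCongr_symm] at h'
  · exact tropicalLinks_isSchonIdeal_map_domCongr e
    
end Summit.ResolutionOfSingularities.ResolutionOfSingularities.Theorems
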